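import Summits.FinalStateConjecture.FinalStateConjecture.Theorems.EIHFluxBalanceInertialRecessionStubEndgameDemocratic
import Summits.FinalStateConjecture.FinalStateConjecture.Theorems.EIHFluxBalanceInertialRecessionStubEndgameClasses

/-!
# Route EIHFluxBalance — crux `InertialRecession`, line `sublinear-is-free-clean-window-charges`:
# the endgame for TWO holes (democratic pair ⇒ dichotomy ⇒ Cesàro velocities)

Helper file for the crux `stmt-FinalStateConjecture-10166`
(`Summit.FinalStateConjecture.FinalStateConjecture.Theses.EIHFluxBalance.InertialRecession`), registered stub
`stub_cesaroEndgame` (r6; since reshape r7 `stub_pairwiseDichotomy`) of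
`Cruxes/InertialRecession/Lines/sublinear_is_free_clean_window_charges.lean`.

A pair exhausting the configuration (`∀ l, l = i ∨ l = j`) is democratic with `θ = 1` (there is no third hole), so
`pair_dichotomy_democratic` gives the PAIRWISE DICHOTOMY (`pair_dichotomy_of_two`), and the class reduction
(`exists_cesaro_of_dichotomy`) the Cesàro velocities: the registered endgame holds for `N ≤ 2` (`cesaroEndgame_of_le_two`).

References: C. Marchal, D. Saari, J. Differential Equations 20 (1976) 150–186; D. Saari, Trans. AMS 156 (1971) 219–240.
-/

noncomputable section

set_option linter.dupNamespace false

open Filter Topology Set MeasureTheory intervalIntegral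
open scoped Topology

namespace Summit.FinalStateConjecture.FinalStateConjecture.Theorems.SublinearIsFree.Endgame

open Literature.Geometry.Lorentzian

/-- THE PAIRWISE DICHOTOMY FOR A PAIR EXHAUSTING THE CONFIGURATION (`N = 2` in effect): either the two centres separate
linearly or their velocities equalise (`pair_dichotomy_democratic` with `θ = 1`). [folklore] -/
theorem pair_dichotomy_of_two (N : ℕ) (M : Fin N → ℝ) (ξ v : Fin N → ℝ → E3) (κ : ℝ)
    (P : ℝ → E3 → ℝ → Fin 4 → ℝ) (hM : ∀ i, 0 < M i) (hκ0 : 0 < κ) (hκ1 : κ < 1)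
    (hsmooth : ∀ i, ContDiff ℝ ((⊤ : ℕ∞) : WithTop ℕ∞) (ξ i))
    (hcone : ∀ i, ∀ᶠ t in atTop, ‖ξ i t‖ ≤ κ ^ 2 * t)
    (hk : ∃ k : ℝ, 0 ≤ k ∧ k < 1 ∧ ∀ i t, ‖v i t‖ ≤ k)
    (hcontv : ∀ i, Continuous (v i))
    (hslave : ∀ i, Tendsto (fun t ↦ deriv (ξ i) t - v i t) atTop (𝓝 0))
    (hWL : ∀ ρ : ℝ → ℝ, Tendsto ρ atTop atTop → ∀ δ : ℝ, 0 < δ → δ < 1 → ∃ (C T : ℝ),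
      ∀ (t₁ t₂ : ℝ) (c : ℝ → E3) (R : ℝ → ℝ), T ≤ t₁ → t₁ ≤ t₂ →
      (∀ s ∈ Set.Icc t₁ t₂, ∀ s' ∈ Set.Icc t₁ t₂, ‖c s - c s'‖ ≤ 2 * |s - s'| ∧ |R s - R s'| ≤ 2 * |s - s'|) →
      (∀ s ∈ Set.Icc t₁ t₂, ρ s ≤ δ * R s ∧ ‖c s‖ + R s ≤ (κ + κ ^ 2) / 2 * s ∧
        ∀ j, ‖ξ j s - c s‖ ≤ (1 - δ) * R s ∨ (1 + δ) * R s ≤ ‖ξ j s - c s‖) →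
      ∀ μ : Fin 4, |P t₂ (c t₂) (R t₂) μ - P t₁ (c t₁) (R t₁) μ| ≤ C * ∫ s in t₁..t₂, (R s ^ (3 / 2 : ℝ))⁻¹)
    (hID : ∀ ρ : ℝ → ℝ, Tendsto ρ atTop atTop → ∀ δ : ℝ, 0 < δ → δ < 1 → ∃ (T : ℝ) (ζ : ℝ → ℝ),
      Tendsto ζ atTop (𝓝 0) ∧ ∀ (t : ℝ) (c : E3) (R : ℝ) (A : Finset (Fin N)), T ≤ t → ρ t ≤ δ * R →
      ‖c‖ + R ≤ (κ + κ ^ 2) / 2 * t →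
      (∀ j, ‖ξ j t - c‖ ≤ (1 - δ) * R ∨ (1 + δ) * R ≤ ‖ξ j t - c‖) → (∀ j, j ∈ A ↔ ‖ξ j t - c‖ ≤ (1 - δ) * R) →
      |P t c R 0 - ∑ j ∈ A, M j * (√(1 - ‖v j t‖ ^ 2))⁻¹| ≤ ζ t ∧
      ∀ k : Fin 3, |P t c R k.succ - ∑ j ∈ A, M j * (√(1 - ‖v j t‖ ^ 2))⁻¹ * v j t k| ≤ ζ t)
    (i j : Fin N) (hij : i ≠ j) (hpair : ∀ l, l = i ∨ l = j)
    (hsep : Tendsto (fun t ↦ ‖ξ j t - ξ i t‖) atTop atTop) :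
    (∃ σ : ℝ, 0 < σ ∧ ∀ᶠ t in atTop, σ * t ≤ ‖ξ j t - ξ i t‖) ∨
      Tendsto (fun t ↦ v j t - v i t) atTop (𝓝 0) :=
  pair_dichotomy_democratic N M ξ v κ P hM hκ0 hκ1 hsmooth hcone hk hcontv hslave hWL hID i j hij one_pos le_rfl
    (Eventually.of_forall fun _ l hli hlj ↦ ((hpair l).elim (fun h ↦ absurd h hli) fun h ↦ absurd h hlj)) hsep

/-- THE REGISTERED ENDGAME FOR `N ≤ 2`: abstract window charges ⇒ Cesàro velocities, for at most two holes
(`pair_dichotomy_of_two` + `exists_cesaro_of_dichotomy`). The statement is the registered stub `stub_cesaroEndgame`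
with the extra hypothesis `N ≤ 2`. [folklore] -/
theorem cesaroEndgame_of_le_two :
    ∀ (N : ℕ) (M : Fin N → ℝ) (ξ v : Fin N → ℝ → E3) (κ : ℝ) (P : ℝ → E3 → ℝ → Fin 4 → ℝ), N ≤ 2 →
      (∀ i, 0 < M i) → 0 < κ → κ < 1 → (∀ i, ContDiff ℝ ((⊤ : ℕ∞) : WithTop ℕ∞) (ξ i)) →
      (∀ i, ∀ᶠ t in atTop, ‖ξ i t‖ ≤ κ ^ 2 * t) →
      (∀ i j, i ≠ j → Tendsto (fun t ↦ ‖ξ i t - ξ j t‖) atTop atTop) →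
      (∀ i, Continuous (v i)) → (∃ k : ℝ, 0 ≤ k ∧ k < 1 ∧ ∀ i t, ‖v i t‖ ≤ k) →
      (∀ i, Tendsto (fun t ↦ deriv (ξ i) t - v i t) atTop (𝓝 0)) →
      (∀ ρ : ℝ → ℝ, Tendsto ρ atTop atTop → ∀ δ : ℝ, 0 < δ → δ < 1 → ∃ (C T : ℝ),
        ∀ (t₁ t₂ : ℝ) (c : ℝ → E3) (R : ℝ → ℝ), T ≤ t₁ → t₁ ≤ t₂ →
        (∀ s ∈ Set.Icc t₁ t₂, ∀ s' ∈ Set.Icc t₁ t₂, ‖c s - c s'‖ ≤ 2 * |s - s'| ∧ |R s - R s'| ≤ 2 * |s - s'|) →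
        (∀ s ∈ Set.Icc t₁ t₂, ρ s ≤ δ * R s ∧ ‖c s‖ + R s ≤ (κ + κ ^ 2) / 2 * s ∧
          ∀ j, ‖ξ j s - c s‖ ≤ (1 - δ) * R s ∨ (1 + δ) * R s ≤ ‖ξ j s - c s‖) →
        ∀ μ : Fin 4, |P t₂ (c t₂) (R t₂) μ - P t₁ (c t₁) (R t₁) μ| ≤ C * ∫ s in t₁..t₂, (R s ^ (3 / 2 : ℝ))⁻¹) →
      (∀ ρ : ℝ → ℝ, Tendsto ρ atTop atTop → ∀ δ : ℝ, 0 < δ → δ < 1 → ∃ (T : ℝ) (ζ : ℝ → ℝ),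
        Tendsto ζ atTop (𝓝 0) ∧ ∀ (t : ℝ) (c : E3) (R : ℝ) (A : Finset (Fin N)), T ≤ t → ρ t ≤ δ * R →
        ‖c‖ + R ≤ (κ + κ ^ 2) / 2 * t →
        (∀ j, ‖ξ j t - c‖ ≤ (1 - δ) * R ∨ (1 + δ) * R ≤ ‖ξ j t - c‖) → (∀ j, j ∈ A ↔ ‖ξ j t - c‖ ≤ (1 - δ) * R) →
        |P t c R 0 - ∑ j ∈ A, M j * (√(1 - ‖v j t‖ ^ 2))⁻¹| ≤ ζ t ∧
        ∀ k : Fin 3, |P t c R k.succ - ∑ j ∈ A, M j * (√(1 - ‖v j t‖ ^ 2))⁻¹ * v j t k| ≤ ζ t) →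
      ∀ i, ∃ V : E3, Tendsto (fun t : ℝ ↦ t⁻¹ • ξ i t) atTop (𝓝 V) := by
  intro N M ξ v κ P hN hM hκ0 hκ1 hsmooth hcone hsep hcontv hk hslave hWL hID
  refine exists_cesaro_of_dichotomy N M ξ v κ P hM hκ0 hκ1 hsmooth hcone hk hslave hWL hID fun i j ↦ ?_
  by_cases hij : i = j
  · subst hij
    right
    simp
  · -- with at most two holes, `i` and `j` exhaust the configuration
    have hpair : ∀ l, l = i ∨ l = j := by
      intro l
      by_contra h
      push Not at h
      have hcard : ({i, j, l} : Finset (Fin N)).card = 3 := by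
        rw [Finset.card_insert_of_notMem, Finset.card_insert_of_notMem, Finset.card_singleton]
        · simpa using fun h' ↦ h.2 h'.symm
        · simp only [Finset.mem_insert, Finset.mem_singleton, not_or]
          exact ⟨hij, fun h' ↦ h.1 h'.symm⟩
      have hle : ({i, j, l} : Finset (Fin N)).card ≤ N := by
        simpa using Finset.card_le_univ ({i, j, l} : Finset (Fin N))
      omega
    exact pair_dichotomy_of_two N M ξ v κ P hM hκ0 hκ1 hsmooth hcone hk hcontv hslave hWL hID i j hij hpair
      (hsep j i (Ne.symm hij))

end Summit.FinalStateConjecture.FinalStateConjecture.Theorems.SublinearIsFree.Endgame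

end
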